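import Literature.AnabelianGeometry.SemiGraphs.OneVertexWitness
import HarnessLib

/-!
# The one-vertex witness over a profinite group `P`: every covering is tempered, `B^temp ≌ B^temp(P)`, and the
# EXPLICIT tempered fundamental group chart `π₁^temp = P` ([SemiAnbd] Def. 3.5, Prop. 3.6 (ii), Thm. 3.7 (i))

Mochizuki, *Semi-graphs of anabelioids*, Publ. RIMS **42** (2006) [MochizukiSemiAnbd2006], §3 Def. 3.5 (i)(ii)
(coverings / tempered coverings, p. 37), Prop. 3.6 (ii) (`B^temp(π₁^temp(𝒢)) ⥲ B^temp(𝒢)`, p. 38), Thm. 3.7 (i)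
(verticial subgroups, p. 40), Prop. 3.2 (p. 35).

Companion of `OneVertexWitness.lean` (abc-iut cell §4(iii) NON-VACUITY lane, seat abc-iut-L3-t2 gen 3; DEFS-FREEZE
convention «DEF NEW — reason» posted; not a cone definition): the GENERIC version of seat abc-iut-w5-d236's
`Prop36HypothesesWitnessAffChart.lean` (untouched), `Aff(ℤ_p)` replaced by any profinite `P` with a `LevelFamily`.
For the one-vertex edgeless semi-graph of anabelioids `OneVertex.graph P` a covering IS its `P`-set at the vertex
and EVERY covering is tempered (the stabiliser of a point is open, so contains some normal `N_n`, which then fixes the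
whole component; `P/N_n` splits it): `OneVertex.isTempered_covObj`; hence `B^temp(graph P) ≌ B^temp(P)` by
`S ↦ S_v` (`OneVertex.temperedEquiv`) and the EXPLICIT chart `OneVertex.chart L` with group `P` ON THE NOSE (given
`SecondCountableTopology P`; no appeal to `ExistsTemperedPiChart_holds`); the identity of `P` is a verticial
homomorphism (`OneVertex.isVerticialHom_id`), `⊤` is a verticial subgroup, and by Prop. 3.2 (`ResIsoResIff_holds`)
the verticial subgroups at the vertex are EXACTLY `{⊤}` (`OneVertex.verticialSubgroups_chart_eq`).  A witness
certifies consistency only; no statement of the paper is touched, strengthened or assumed; no instance, no notation,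
no `Prop` fact. Nothing here bears on [IUTchIII] Cor. 3.12.
-/

noncomputable section

namespace Literature.AnabelianGeometry.SemiGraphs

namespace ProfiniteSemiGraph

open CategoryTheory Topology
open Literature.AlgebraicGeometry.Frobenioids (IsSlimGroup)
open Literature.AlgebraicGeometry.Frobenioids.QuasiTemperoid.BTempConnected
  (hom_ext_apply ρ_one_apply ρ_mul_apply)

universe u

namespace OneVertex

variable {P : Type u} [Group P] [TopologicalSpace P] [IsTopologicalGroup P] [CompactSpace P]
  [TotallyDisconnectedSpace P]

/-! ### Coverings of the witness are `P`-sets; every covering is tempered -/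

/-- The covering of the witness with vertex fibre `X` (no edges to glue). [cite: MochizukiSemiAnbd2006, Def 3.5(i) p.37] -/
def covObj (X : BTemp P) : CovObj (graph P) where
  SV := fun _ => X
  SE := fun e => nomatch e
  glue := fun b => nomatch b

/-- Every covering of the witness is the covering with its own vertex fibre. [cite: MochizukiSemiAnbd2006, Def 3.5(i) p.37] -/
theorem covObj_SV (S : CovObj (graph P)) : covObj (S.SV PUnit.unit) = S := by
  obtain ⟨SV, SE, glue⟩ := S
  have hSE : SE = fun e => nomatch e := funext fun e => nomatch e
  subst hSE
  have hglue : glue = fun b => nomatch b := funext fun b => nomatch b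
  subst hglue
  rfl

/-- The functor `X ↦ (X at the vertex)` from `P`-sets to coverings of the witness.
[cite: MochizukiSemiAnbd2006, Def 3.5(i) p.37] -/
def covFunctor : BTemp P ⥤ CovObj (graph P) where
  obj X := covObj X
  map f := { fV := fun _ => f, fE := fun e => e.elim, comm := fun b => b.elim }
  map_id _ := CovHom.ext (funext fun _ => rfl) (funext fun e => e.elim)
  map_comp _ _ := CovHom.ext (funext fun _ => rfl) (funext fun e => e.elim)

/-- In a `Π`-set, if a normal subgroup `N` fixes `x` then it fixes `g · x`. [folklore] -/
private theorem fixed_smul_of_normal {G : Type u} [Group G] [TopologicalSpace G] (N : Subgroup G)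
    (hN : N.Normal) (X : BTemp G) (x : X.obj.V) (g : G) (hx : ∀ γ ∈ N, X.obj.ρ γ x = x) :
    ∀ γ ∈ N, X.obj.ρ γ (X.obj.ρ g x) = X.obj.ρ g x := by
  intro γ hγ
  have hc : g⁻¹ * γ * g⁻¹⁻¹ ∈ N := hN.conj_mem γ hγ g⁻¹
  rw [inv_inv] at hc
  calc X.obj.ρ γ (X.obj.ρ g x)
      = X.obj.ρ (g * (g⁻¹ * γ * g)) x := by
        rw [← ρ_mul_apply]; congr 1; group
    _ = X.obj.ρ g x := by rw [ρ_mul_apply, hx _ hc]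

/-- In a `Π`-set, a normal subgroup `N` fixes `x` iff it fixes `g · x`. [folklore] -/
private theorem fixed_iff_fixed_smul_of_normal {G : Type u} [Group G] [TopologicalSpace G]
    (N : Subgroup G) (hN : N.Normal) (X : BTemp G) (x : X.obj.V) (g : G) :
    (∀ γ ∈ N, X.obj.ρ γ x = x) ↔ ∀ γ ∈ N, X.obj.ρ γ (X.obj.ρ g x) = X.obj.ρ g x := by
  refine ⟨fixed_smul_of_normal N hN X x g, fun h => ?_⟩
  have h' := fixed_smul_of_normal N hN X (X.obj.ρ g x) g⁻¹ h
  rwa [← ρ_mul_apply, inv_mul_cancel, ρ_one_apply] at h'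

/-- `N_n` fixes the point `t` of the vertex fibre. [cite: MochizukiSemiAnbd2006, Def 3.5(ii) p.37] -/
private def FixedByLevel (L : LevelFamily P) (S : CovObj (graph P)) (n : ℕ) : S.Point → Prop
  | Sum.inl ⟨v, t⟩ => ∀ γ : (graph P).Gv v, γ ∈ L.N n → (S.SV v).obj.ρ γ t = t
  | Sum.inr ⟨e, _⟩ => nomatch e

/-- `N_n`-fixedness is invariant along the adjacency relation generating the components (normality of `N_n`).
[cite: MochizukiSemiAnbd2006, Def 3.5(ii) p.37] -/
private theorem fixedByLevel_iff_of_adj (L : LevelFamily P) (S : CovObj (graph P)) (n : ℕ) {a b : S.Point}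
    (h : S.Adj a b) : FixedByLevel L S n a ↔ FixedByLevel L S n b := by
  cases h with
  | vertex v g x =>
    exact fixed_iff_fixed_smul_of_normal (G := (graph P).Gv v) (L.N n) (L.normal n) (S.SV v) x g
  | edge e => exact nomatch e
  | glue b => exact nomatch b

/-- `N_n`-fixedness is constant on connected components. [cite: MochizukiSemiAnbd2006, Def 3.5(ii) p.37] -/
private theorem fixedByLevel_iff_of_sameComponent (L : LevelFamily P) (S : CovObj (graph P)) (n : ℕ)
    {a b : S.Point} (h : S.SameComponent a b) : FixedByLevel L S n a ↔ FixedByLevel L S n b := by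
  induction h with
  | rel x y hxy => exact fixedByLevel_iff_of_adj L S n hxy
  | refl x => exact Iff.rfl
  | symm x y _ ih => exact ih.symm
  | trans x y z _ _ ih₁ ih₂ => exact ih₁.trans ih₂

/-- **Every covering of the witness is tempered** (Def. 3.5 (ii)): the component of a point `t` is split by the
finite covering `P/N_n` for any `N_n` inside the (open) stabiliser of `t`. [cite: MochizukiSemiAnbd2006, Def 3.5(ii) p.37] -/
theorem isTempered_covObj (L : LevelFamily P) (S : CovObj (graph P)) : S.IsTempered := by
  intro q
  rcases q with ⟨v, t⟩ | ⟨e, _⟩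
  · have h1 : (1 : P) ∈ {g : P | (S.SV v).obj.ρ g t = t} := ρ_one_apply _ t
    obtain ⟨n, hsub⟩ := L.basis _ ((S.SV v).property.2 t) h1
    have hq : FixedByLevel L S n (Sum.inl ⟨v, t⟩) := fun γ hγ => hsub (a := γ) hγ
    refine ⟨levelCov L n, levelCov_isFinite L n, levelCov_hasNonemptyFibres L n, fun q hpq => ?_⟩
    have hq' := (fixedByLevel_iff_of_sameComponent L S n hpq).mp hq
    rcases q with ⟨w, s⟩ | ⟨e, _⟩
    · intro x g hgx
      exact hq' g (mem_level_of_fix L n x g hgx)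
    · exact nomatch e
  · exact nomatch e

/-! ### `B^temp(graph P) ≌ B^temp(P)` -/

/-- The functor `B^temp(P) ⥤ B^temp(graph P)`, `X ↦` the covering with vertex fibre `X`.
[cite: MochizukiSemiAnbd2006, Def 3.5(ii) p.37] -/
def extend (L : LevelFamily P) : BTemp P ⥤ BTempCat (graph P) :=
  ObjectProperty.lift _ covFunctor fun _ => isTempered_covObj L _

/-- The functor `B^temp(graph P) ⥤ B^temp(P)`, `S ↦ S_v` (restriction to the vertex).
[cite: MochizukiSemiAnbd2006, Def 3.5(ii) p.37] -/
def restrict : BTempCat (graph P) ⥤ BTemp P :=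
  ObjectProperty.ι _ ⋙ restrictV (graph P) PUnit.unit

/-- A tempered covering of the witness is (isomorphic, by identity maps, to) the covering with its own vertex
fibre. [cite: MochizukiSemiAnbd2006, Def 3.5(ii) p.37] -/
def unitIso (L : LevelFamily P) (S : BTempCat (graph P)) : S ≅ (extend L).obj ((restrict (P := P)).obj S) :=
  ObjectProperty.isoMk _
    { hom := { fV := fun v => 𝟙 (S.obj.SV v), fE := fun e => e.elim, comm := fun b => b.elim }
      inv := { fV := fun v => 𝟙 (S.obj.SV v), fE := fun e => e.elim, comm := fun b => b.elim }
      hom_inv_id := CovHom.ext (funext fun _ => Category.id_comp _) (funext fun e => e.elim)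
      inv_hom_id := CovHom.ext (funext fun _ => Category.id_comp _) (funext fun e => e.elim) }

/-- **`B^temp(graph P) ≌ B^temp(P)`** via `S ↦ S_v`: a tempered covering of the one-vertex edgeless semi-graph
of anabelioids `B(P)` IS a countable discrete continuous `P`-set. [cite: MochizukiSemiAnbd2006, Prop 3.6(ii) p.38] -/
def temperedEquiv (L : LevelFamily P) : BTempCat (graph P) ≌ BTemp P :=
  CategoryTheory.Equivalence.mk restrict (extend L)
    (NatIso.ofComponents (unitIso L) fun f => ObjectProperty.hom_ext _
      (CovHom.ext (funext fun v => by
          cases v; exact (Category.comp_id _).trans (Category.id_comp _).symm)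
        (funext fun e => e.elim)))
    (NatIso.ofComponents (fun _ => Iso.refl _) fun _ => rfl)

/-- The inverse of `temperedEquiv` is `extend` (definitionally). [cite: MochizukiSemiAnbd2006, Prop 3.6(ii) p.38] -/
theorem temperedEquiv_inverse (L : LevelFamily P) : (temperedEquiv L).inverse = extend L := rfl

/-- The functor of `temperedEquiv` is the restriction to the vertex (definitionally).
[cite: MochizukiSemiAnbd2006, Prop 3.6(ii) p.38] -/
theorem temperedEquiv_functor (L : LevelFamily P) : (temperedEquiv L).functor = restrict (P := P) := rfl

/-! ### The explicit chart -/

/-- **The explicit tempered fundamental group chart of the witness**: `π₁^temp(graph P)` may be taken to be `P`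
itself, with `B^temp(graph P) ≌ B^temp(P)` the restriction to the vertex ([IUTchI] Rmk. 2.5.3 (i) (T6) asks
`π₁^temp` to be Galois-countable: `SecondCountableTopology P`). [cite: MochizukiSemiAnbd2006, Prop 3.6(ii) p.38] -/
def chart (L : LevelFamily P) [SecondCountableTopology P] : TemperedPiChart (graph P) where
  G := P
  isTempered := isTempered
  secondCountableTopology := inferInstance
  equiv := temperedEquiv L

/-- The group of the explicit chart is `P` (definitionally). [cite: MochizukiSemiAnbd2006, Prop 3.6(ii) p.38] -/
theorem chart_G (L : LevelFamily P) [SecondCountableTopology P] : (chart L).G = P := rfl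

/-! ### The identity is a verticial homomorphism; `⊤` is a verticial subgroup -/

/-- `X ≅ B^temp(id)(X)` by the identity map. [cite: MochizukiSemiAnbd2006, Rmk 3.1.2 pp.33-34] -/
def resIdIso (X : BTemp P) : X ≅ (BTemp.res (ContinuousMonoidHom.id P)).obj X where
  hom := ObjectProperty.homMk
    { hom := TypeCat.ofHom fun x : X.obj.V => (x : X.obj.V)
      comm := fun g => by
        apply ConcreteCategory.hom_ext
        intro x
        rfl }
  inv := ObjectProperty.homMk
    { hom := TypeCat.ofHom fun x : X.obj.V => (x : X.obj.V)
      comm := fun g => by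
        apply ConcreteCategory.hom_ext
        intro x
        rfl }
  hom_inv_id := hom_ext_apply fun _ => rfl
  inv_hom_id := hom_ext_apply fun _ => rfl

/-- For the explicit chart, `equiv.inverse ⋙ ι ⋙ restrictV` is (isomorphic by identity maps to) `B^temp(id_P)`.
[cite: MochizukiSemiAnbd2006, Thm 3.7(i) p.40] -/
def chartRestrictIso (L : LevelFamily P) [SecondCountableTopology P] :
    (chart L).equiv.inverse ⋙ ObjectProperty.ι _ ⋙ restrictV (graph P) PUnit.unit ≅
      BTemp.res (ContinuousMonoidHom.id P) :=
  NatIso.ofComponents (fun X => resIdIso X) fun _ => hom_ext_apply fun _ => rfl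

/-- **The identity of `P` is a verticial homomorphism** at the vertex, for the explicit chart.
[cite: MochizukiSemiAnbd2006, Thm 3.7(i) p.40] -/
theorem isVerticialHom_id (L : LevelFamily P) [SecondCountableTopology P] (v : (graph P).graph.Vertex) :
    IsVerticialHom (chart L) v (ContinuousMonoidHom.id P) :=
  ⟨chartRestrictIso L⟩

/-- **The whole group `P` is a verticial subgroup** of `π₁^temp(graph P) = P` (explicit chart).
[cite: MochizukiSemiAnbd2006, Thm 3.7(i) p.40] -/
theorem top_mem_verticialSubgroups (L : LevelFamily P) [SecondCountableTopology P] (v : (graph P).graph.Vertex) :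
    (⊤ : Subgroup P) ∈ verticialSubgroups (chart L) v := by
  refine ⟨ContinuousMonoidHom.id P, ⟨chartRestrictIso L⟩, ?_⟩
  ext g
  simp only [Subgroup.mem_top, true_iff]
  exact ⟨g, rfl⟩

/-- The verticial subgroups of the explicit chart at the vertex are nonempty — by the explicit element `⊤`.
[cite: MochizukiSemiAnbd2006, Thm 3.7(i) p.40] -/
theorem verticialSubgroups_chart_nonempty (L : LevelFamily P) [SecondCountableTopology P] (v : (graph P).graph.Vertex) :
    (verticialSubgroups (chart L) v).Nonempty :=
  ⟨⊤, top_mem_verticialSubgroups L v⟩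

/-- **Every verticial homomorphism of the explicit chart is an inner automorphism of `P`** (Prop. 3.2, injectivity
half `ResIsoResIff_holds`, applied to `B^temp(φ) ≅ B^temp(id)`). [cite: MochizukiSemiAnbd2006, Prop 3.2 p.35] -/
theorem exists_conj_eq_of_isVerticialHom (L : LevelFamily P) [SecondCountableTopology P] (v : (graph P).graph.Vertex)
    (φ : (graph P).Gv v →ₜ* (chart L).G) (hφ : IsVerticialHom (chart L) v φ) :
    ∃ g : P, ∀ x : P, g * x * g⁻¹ = φ x := by
  obtain ⟨e⟩ := hφ
  exact (ResIsoResIff_holds P P isTempered isTempered (ContinuousMonoidHom.id P) φ).mp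
    ⟨(chartRestrictIso L).symm ≪≫ e⟩

/-- **The verticial subgroups of the explicit chart are exactly `{P}`**: a verticial homomorphism is an inner
automorphism, so its range is everything. [cite: MochizukiSemiAnbd2006, Thm 3.7(i) p.40] -/
theorem verticialSubgroups_chart_eq (L : LevelFamily P) [SecondCountableTopology P] (v : (graph P).graph.Vertex) :
    verticialSubgroups (chart L) v = {⊤} := by
  ext H
  constructor
  · rintro ⟨φ, hφ, rfl⟩
    obtain ⟨g, hg⟩ := exists_conj_eq_of_isVerticialHom L v φ hφ
    rw [Set.mem_singleton_iff, eq_top_iff]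
    intro y _
    obtain ⟨y, rfl⟩ : ∃ y' : P, y' = y := ⟨y, rfl⟩
    refine ⟨g⁻¹ * y * g, ?_⟩
    change φ (g⁻¹ * y * g) = y
    rw [← hg]
    group
  · rintro rfl
    exact top_mem_verticialSubgroups L v

end OneVertex

end ProfiniteSemiGraph

end Literature.AnabelianGeometry.SemiGraphs

end
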